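import Literature.Probability.RandomPlanarGeometry.SAWPulledLargeForceExpansionZdTenStep
import Literature.Probability.RandomPlanarGeometry.SAWIrreducibleBridgeSpanOne
import HarnessLib

/-!
# «ZD-BRIDGE-WORDS»: the cost census of irreducible bridges as a word count, its symmetries, and the census by the search engine

Topic `Literature/Probability/RandomPlanarGeometry` (sequel of `…ZdWordSearch` #593 / `…ZdTenStep` #601, toward the remaining cells of the
cost-nine column `N_{9,11}`, `N_{9,12}` of the pulled large-force expansion).  The irreducible bridges of `ℤ^{d+1}` of length `n+1`
are read as STEP WORDS over `Idx (d+1)` (Grimmett's coding, `SAWCountStepWords`): (1) bridge / renewal / irreducibility conditions on a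
height function (`IsBridgeH`, `IsRenewalH`, `IsIrrH` — definitionally the tree's `IsBridge`, `IsRenewalTime`, `IsIrreducibleBridge` read on
the height coordinate); (2) the height of a word RELATIVE TO ITS FIRST LETTER (`Hgt`; ★ `hgt_eq_wordPos`: for a word starting with a step
up it is the height coordinate of the position; ★ `first_eq_up_of_isBridge`); (3) the BRIDGE CLASS `QB c` (self-avoiding, irreducible
bridge along the axis of the first letter, cost `c`) and ★★ `costCoeffZd_eq_card_qb`: `N_{c,n+1}(ℤ^{d+1}) = #{u : Word (n+1) (d+1) | u 0 = (0,true) ∧ QB c u}`;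
(4) the class is a TYPE invariant (`qb_iff_canon`), FLIP invariant (`qb_flipW_iff`) and invariant under RELABELLING of the axes
(`permW`, `sum_permW_eq_zero_iff`, `qb_permW_iff`); (5) slicing by the first letter (`normFirst`/`denormFirst`, ★ `card_slice_eq`):
★★ `card_qb_eq_mul : #{QB c} = 2(d+1) · #{u 0 = (0,true) ∧ QB c}`; (6) hence, by the reduced census theorem of #601 in dimension `d+1`,
★★★ `two_mul_costCoeffZd_eq_sum` / ★★★ `costCoeffZd_eq_sum_search`: for ANY pruning/class tests `ok`, `cls` of the search engine whose
meaning on words of `Word (n+1) (n+1)` is the bridge class (hypothesis `hsem`), `N_{c,n+1}(ℤ^{d+1}) = Σ_k 2^k m_{k+1} d^{(k)}` with `m_k` the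
REDUCED search counts `dfsN alwR updR ok cls c' k (n+1) [] 0` (canonical bridge words — the pulled axis is axis 0 automatically — with
positive first occurrences and `k` axes in all).  What remains for a cost cell is kernel-side only: efficient raw tests with `hsem`, and
the cell (the seat's Python twin `g20/bridge/job/main.py` reproduces `N_{8,10}`, `N_{8,11}`, `N_{9,13}`, `c₅…c₁₀(ℤ^d)` and
a-p1's `N_{9,11}`, `N_{9,12}`; kit j255032).  [cite: MadrasSlade1993, Definition 1.2.4]
The definitions `IsBridgeH`, `IsRenewalH`, `IsIrrH`, `vs`, `Hgt`, `QB`, `permW`, `posW`, `normFirst`, `denormFirst` are this file's tool notions (not notions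
in print).  No number is taken from print.

Provenance: lane «pcv-sawmu», a-p3 g20 (2026-08-26).
-/

open Finset
open scoped BigOperators
open Literature.Probability.LatticeModels
open Literature.Probability.RandomPlanarGeometry.SAW

namespace Literature.Probability.RandomPlanarGeometry.SAW.Zd

namespace WordTypes

/-! ### Bridge conditions on a height function -/

section heights

/-- Bridge condition on a height function (Madras–Slade Definition 1.2.4 read on heights): `H 0 < H i ≤ H n` for `1 ≤ i ≤ n`.
[cite: MadrasSlade1993, Definition 1.2.4] -/
def IsBridgeH (n : ℕ) (H : ℕ → ℤ) : Prop := ∀ i, 1 ≤ i → i ≤ n → H 0 < H i ∧ H i ≤ H n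

/-- Renewal time `i` of a height function (both pieces are bridges). [cite: MadrasSlade1993, Definition 1.2.4] -/
def IsRenewalH (n : ℕ) (H : ℕ → ℤ) (i : ℕ) : Prop := i ≤ n ∧ IsBridgeH i H ∧ IsBridgeH (n - i) fun k => H (i + k)

/-- Irreducible bridge condition on a height function: a bridge of length `≥ 1` without renewal times in `[1, n-1]`. [cite: MadrasSlade1993, Definition 1.2.4] -/
def IsIrrH (n : ℕ) (H : ℕ → ℤ) : Prop := 1 ≤ n ∧ IsBridgeH n H ∧ ∀ k, 1 ≤ k → k ≤ n - 1 → ¬ IsRenewalH n H k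

/-- The tree's `IsBridge` is `IsBridgeH` of the height coordinate. [cite: MadrasSlade1993, Definition 1.2.4] -/
theorem isBridge_iff_isBridgeH {D n : ℕ} (ω : ℕ → Site (D + 1)) : IsBridge n ω ↔ IsBridgeH n fun i => ω i 0 := Iff.rfl

/-- The tree's `IsRenewalTime` is `IsRenewalH` of the height coordinate. [cite: MadrasSlade1993, Definition 1.2.4] -/
theorem isRenewalTime_iff_isRenewalH {D n : ℕ} (ω : ℕ → Site (D + 1)) (i : ℕ) :
    IsRenewalTime n ω i ↔ IsRenewalH n (fun i => ω i 0) i := Iff.rfl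

/-- The tree's `IsIrreducibleBridge` is `IsIrrH` of the height coordinate. [cite: MadrasSlade1993, Definition 1.2.4] -/
theorem isIrreducibleBridge_iff_isIrrH {D n : ℕ} (ω : ℕ → Site (D + 1)) : IsIrreducibleBridge n ω ↔ IsIrrH n fun i => ω i 0 := Iff.rfl

/-- `IsIrrH` along pointwise-equal height functions. [cite: MadrasSlade1993, Definition 1.2.4] -/
theorem isIrrH_congr {n : ℕ} {H H' : ℕ → ℤ} (h : ∀ i, H i = H' i) : IsIrrH n H ↔ IsIrrH n H' := by
  have : H = H' := funext h
  subst this; exact Iff.rfl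

end heights

/-! ### The height of a step word relative to its first letter -/

section wordheights

variable {n D : ℕ}

/-- The vertical sign of a letter relative to the first letter `f`: `+1` if equal, `−1` if the reversal, `0` off the axis of `f`.
[cite: MadrasSlade1993, Definition 1.2.4] -/
def vs (f a : Idx D) : ℤ := if a.1 = f.1 then (if a.2 = f.2 then 1 else -1) else 0

/-- The height after `i` letters, measured along the axis of the first letter and oriented by it. [cite: MadrasSlade1993, Definition 1.2.4] -/
def Hgt (u : Word (n + 1) D) (i : ℕ) : ℤ := ∑ p ∈ Finset.univ.filter (fun p : Fin (n + 1) => p.val < i), vs (u 0) (u p)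

/-- `Hgt u 0 = 0`. [cite: MadrasSlade1993, Definition 1.2.4] -/
theorem hgt_zero (u : Word (n + 1) D) : Hgt u 0 = 0 := by
  unfold Hgt
  rw [Finset.filter_eq_empty_iff.2 (fun p _ => Nat.not_lt_zero _), Finset.sum_empty]

/-- One more letter. [cite: MadrasSlade1993, Definition 1.2.4] -/
theorem hgt_succ (u : Word (n + 1) D) {i : ℕ} (hi : i < n + 1) : Hgt u (i + 1) = Hgt u i + vs (u 0) (u ⟨i, hi⟩) := by
  unfold Hgt
  have hsplit : (Finset.univ.filter fun p : Fin (n + 1) => p.val < i + 1) =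
      insert (⟨i, hi⟩ : Fin (n + 1)) (Finset.univ.filter fun p : Fin (n + 1) => p.val < i) := by
    ext p
    simp only [Finset.mem_filter, Finset.mem_univ, true_and, Finset.mem_insert, Fin.ext_iff]
    omega
  have hnot : (⟨i, hi⟩ : Fin (n + 1)) ∉ Finset.univ.filter fun p : Fin (n + 1) => p.val < i := by simp
  rw [hsplit, Finset.sum_insert hnot, add_comm]

/-- Frozen after the last letter. [cite: MadrasSlade1993, Definition 1.2.4] -/
theorem hgt_of_le (u : Word (n + 1) D) {i : ℕ} (hi : n + 1 ≤ i) : Hgt u i = Hgt u (n + 1) := by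
  unfold Hgt
  congr 1
  ext p
  simp only [Finset.mem_filter, Finset.mem_univ, true_and]
  constructor <;> intro _ <;> omega

/-- The height coordinate of a step of `ℤ^{D+1}` is its vertical sign relative to `(0, true)`. [cite: MadrasSlade1993, Definition 1.2.4] -/
theorem stepVec_apply_zero' (a : Idx (D + 1)) : Percolation.stepVec a 0 = vs ((0, true) : Idx (D + 1)) a := by
  obtain ⟨x, b⟩ := a
  unfold Percolation.stepVec vs
  by_cases hx : x = 0
  · subst hx; cases b <;> simp
  · cases b <;> simp [hx]

/-- ★ For a word starting with the letter `(0, true)` (a step up), the relative height is the height coordinate of its position.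
[cite: MadrasSlade1993, Definition 1.2.4] -/
theorem hgt_eq_wordPos (u : Word (n + 1) (D + 1)) (h0 : u 0 = (0, true)) (i : ℕ) : Hgt u i = Percolation.wordPos u i 0 := by
  induction i with
  | zero => rw [hgt_zero, Percolation.wordPos_zero]; rfl
  | succ i ih =>
    rcases Nat.lt_or_ge i (n + 1) with hi | hi
    · rw [hgt_succ u hi, Percolation.wordPos_succ u hi, Pi.add_apply, ih, h0, stepVec_apply_zero']
    · rw [hgt_of_le u (by omega), wordPos_of_le u (by omega), ← hgt_of_le u hi, ih, wordPos_of_le u hi]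

/-- ★ A word whose positions form a bridge starts with a step up: `u 0 = (0, true)`. [cite: MadrasSlade1993, Definition 1.2.4] -/
theorem first_eq_up_of_isBridge (u : Word (n + 1) (D + 1)) (h : IsBridge (n + 1) (Percolation.wordPos u)) : u 0 = (0, true) := by
  have h1 := (h 1 le_rfl (by omega)).1
  rw [Percolation.wordPos_zero, Percolation.wordPos_succ u (by omega : 0 < n + 1), Percolation.wordPos_zero, Pi.zero_apply, zero_add,
    stepVec_apply_zero'] at h1
  have e : (⟨0, (by omega : 0 < n + 1)⟩ : Fin (n + 1)) = 0 := rfl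
  rw [e] at h1
  rcases hxb : u 0 with ⟨x, b⟩
  rw [hxb] at h1
  unfold vs at h1
  by_cases hx : x = 0
  · subst hx
    cases b
    · simp at h1
    · rfl
  · simp [hx] at h1

end wordheights


/-! ### The bridge class of a step word, and the cost census as a word count -/

section bridgeclass

variable {n D : ℕ}

/-- ★ THE BRIDGE CLASS OF COST `c` (word level, relative heights): self-avoiding, irreducible bridge along the axis of its first letter,
cost `(n+1) − span = c`. [cite: MadrasSlade1993, §4.2, eq. (4.2.20)–(4.2.22) (p. 94, 2013 reprint)] -/
def QB (c : ℕ) (u : Word (n + 1) D) : Prop := Percolation.IsSAW u ∧ IsIrrH (n + 1) (Hgt u) ∧ n + 1 - (Hgt u (n + 1)).toNat = c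

/-- ★ For a word starting with a step up, the bridge class is the tree's «irreducible bridge of cost `c`» of its positions.
[cite: MadrasSlade1993, §4.2, eq. (4.2.20)–(4.2.22) (p. 94, 2013 reprint)] -/
theorem qb_iff_of_first_up {d : ℕ} (c : ℕ) (u : Word (n + 1) (d + 1)) (h0 : u 0 = (0, true)) :
    QB c u ↔ Percolation.IsSAW u ∧ IsIrreducibleBridge (n + 1) (Percolation.wordPos u) ∧ costZd d (n + 1) (Percolation.wordPos u) = c := by
  unfold QB costZd
  rw [isIrreducibleBridge_iff_isIrrH, isIrrH_congr (fun i => hgt_eq_wordPos u h0 i), hgt_eq_wordPos u h0]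

open Classical in
/-- ★★ THE COST CENSUS AS A WORD COUNT: `N_{c,n+1}(ℤ^{d+1})` is the number of step words of length `n+1` over `ℤ^{d+1}` that start with a
step up and lie in the bridge class of cost `c`. [cite: MadrasSlade1993, §4.2, eq. (4.2.20)–(4.2.22) (p. 94, 2013 reprint)] -/
theorem costCoeffZd_eq_card_qb (d c n : ℕ) :
    costCoeffZd d c (n + 1) = (Finset.univ.filter fun u : Word (n + 1) (d + 1) => u 0 = (0, true) ∧ QB c u).card := by
  classical
  unfold costCoeffZd
  rw [show irreducibleBridges (d + 1) (n + 1) = ((saws (d + 1) (n + 1)).filter (IsBridge (n + 1))).filter (IsIrreducibleBridge (n + 1)) from rfl,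
    ← image_wordPos_sawWords, Finset.filter_image, Finset.filter_image, Finset.filter_image,
    Finset.card_image_of_injOn (fun u _ v _ h => wordPos_injective (n + 1) h)]
  unfold Percolation.sawWords
  congr 1
  ext u
  simp only [Finset.mem_filter, Finset.mem_univ, true_and, and_assoc]
  constructor
  · rintro ⟨hs, hb, hi, hc⟩
    have h0 := first_eq_up_of_isBridge u hb
    exact ⟨h0, (qb_iff_of_first_up c u h0).2 ⟨hs, hi, hc⟩⟩
  · rintro ⟨h0, hq⟩
    obtain ⟨hs, hi, hc⟩ := (qb_iff_of_first_up c u h0).1 hq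
    exact ⟨hs, hi.2.1, hi, hc⟩

/-! ### Invariances of the bridge class: axis types, sign flips, axis permutations -/

/-- The relative height is a type invariant. [cite: MadrasSlade1993, Definition 1.2.4] -/
theorem hgt_canon (u : Word (n + 1) D) (i : ℕ) : Hgt (canon u) i = Hgt u i := by
  unfold Hgt
  refine Finset.sum_congr rfl fun p _ => ?_
  have h := sameType_canon u
  unfold vs
  have ha : ((canon u p).1 = (canon u 0).1) ↔ ((u p).1 = (u 0).1) := (h.1 p 0).symm
  rw [h.2 p, h.2 0]
  by_cases hp : (u p).1 = (u 0).1
  · rw [if_pos (ha.2 hp), if_pos hp]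
  · rw [if_neg (fun hh => hp (ha.1 hh)), if_neg hp]

/-- ★ The bridge class is a type invariant. [cite: MadrasSlade1993, Definition 1.2.4] -/
theorem qb_iff_canon (c : ℕ) (u : Word (n + 1) D) : QB c u ↔ QB c (canon u) := by
  unfold QB
  rw [isIrrH_congr (fun i => hgt_canon u i), hgt_canon, isSAW_iff_blocks, isSAW_iff_blocks]
  unfold bsumW
  simp only [ne_eq, (sameType_canon u).sum_eq_zero_iff]

/-- The relative height is flip-invariant. [cite: MadrasSlade1993, Definition 1.2.4] -/
theorem hgt_flipW (S : Finset (Fin D)) (u : Word (n + 1) D) (i : ℕ) : Hgt (flipW S u) i = Hgt u i := by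
  unfold Hgt
  refine Finset.sum_congr rfl fun p _ => ?_
  unfold vs
  rw [flipW_fst, flipW_fst, flipW_snd, flipW_snd]
  by_cases hp : (u p).1 = (u 0).1
  · rw [if_pos hp, if_pos hp, hp]
    split_ifs <;> simp_all
  · rw [if_neg hp, if_neg hp]

/-- ★ The bridge class is flip-invariant. [cite: MadrasSlade1993, Definition 1.2.4] -/
theorem qb_flipW_iff (S : Finset (Fin D)) (c : ℕ) (u : Word (n + 1) D) : QB c (flipW S u) ↔ QB c u := by
  unfold QB
  rw [isIrrH_congr (fun i => hgt_flipW S u i), hgt_flipW, isSAW_iff_blocks, isSAW_iff_blocks]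
  unfold bsumW
  simp only [ne_eq, sum_flipW_eq_zero_iff]

/-- Relabel the axes of a word by a permutation. [cite: MadrasSlade1993, Definition 1.2.4] -/
def permW (σ : Equiv.Perm (Fin D)) (u : Word (n + 1) D) : Word (n + 1) D := fun p => (σ (u p).1, (u p).2)

/-- A block sum of a relabelled word vanishes iff the original one does. [cite: MadrasSlade1993, Definition 1.2.4] -/
theorem sum_permW_eq_zero_iff (σ : Equiv.Perm (Fin D)) (u : Word (n + 1) D) (t : Finset (Fin (n + 1))) :
    ∑ p ∈ t, twoStepV D (permW σ u p) = 0 ↔ ∑ p ∈ t, twoStepV D (u p) = 0 := by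
  rw [sum_twoStepV_eq_zero_iff, sum_twoStepV_eq_zero_iff]
  have key : ∀ (x : Fin D) (b : Bool), (t.filter fun p => permW σ u p = (x, b)) = t.filter fun p => u p = (σ.symm x, b) := by
    intro x b
    refine Finset.filter_congr fun p _ => ?_
    unfold permW
    obtain ⟨y, c⟩ := u p
    simp only [Prod.mk.injEq, Equiv.eq_symm_apply]
  constructor
  · intro h x
    have := h (σ x)
    rwa [key, key, Equiv.symm_apply_apply] at this
  · intro h x
    rw [key, key]
    exact h _

/-- The relative height is invariant under relabelling. [cite: MadrasSlade1993, Definition 1.2.4] -/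
theorem hgt_permW (σ : Equiv.Perm (Fin D)) (u : Word (n + 1) D) (i : ℕ) : Hgt (permW σ u) i = Hgt u i := by
  unfold Hgt
  refine Finset.sum_congr rfl fun p _ => ?_
  unfold vs permW
  simp only [Equiv.apply_eq_iff_eq]

/-- ★ The bridge class is invariant under relabelling of the axes. [cite: MadrasSlade1993, Definition 1.2.4] -/
theorem qb_permW_iff (σ : Equiv.Perm (Fin D)) (c : ℕ) (u : Word (n + 1) D) : QB c (permW σ u) ↔ QB c u := by
  unfold QB
  rw [isIrrH_congr (fun i => hgt_permW σ u i), hgt_permW, isSAW_iff_blocks, isSAW_iff_blocks]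
  unfold bsumW
  simp only [ne_eq, sum_permW_eq_zero_iff]

end bridgeclass


/-! ### Slicing by the first letter: every letter class has the size of the step-up class -/

section slices

variable {n D : ℕ}

/-- Relabelling twice by a transposition is the identity. [cite: MadrasSlade1993, Definition 1.2.4] -/
theorem permW_swap_permW_swap (a b : Fin D) (u : Word (n + 1) D) : permW (Equiv.swap a b) (permW (Equiv.swap a b) u) = u := by
  funext p; unfold permW; simp [Equiv.swap_apply_self]

/-- Make the first step positive: flip axis `0`'s signs unless `b`. [cite: MadrasSlade1993, Definition 1.2.4] -/
def posW (b : Bool) (u : Word (n + 1) (D + 1)) : Word (n + 1) (D + 1) := if b then u else flipW {0} u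

/-- `posW b` is an involution. [cite: MadrasSlade1993, Definition 1.2.4] -/
theorem posW_posW (b : Bool) (u : Word (n + 1) (D + 1)) : posW b (posW b u) = u := by
  unfold posW; cases b <;> simp [flipW_flipW]

/-- `posW b` keeps the bridge class. [cite: MadrasSlade1993, Definition 1.2.4] -/
theorem qb_posW_iff (b : Bool) (c : ℕ) (u : Word (n + 1) (D + 1)) : QB c (posW b u) ↔ QB c u := by
  unfold posW; cases b
  · exact qb_flipW_iff _ c u
  · exact Iff.rfl

/-- Normalising the first letter `(a, b)` to `(0, true)`: swap the axes `a, 0`, then make the first step positive. [cite: MadrasSlade1993, Definition 1.2.4] -/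
def normFirst (a : Fin (D + 1)) (b : Bool) (u : Word (n + 1) (D + 1)) : Word (n + 1) (D + 1) := posW b (permW (Equiv.swap a 0) u)

/-- The inverse normalisation. [cite: MadrasSlade1993, Definition 1.2.4] -/
def denormFirst (a : Fin (D + 1)) (b : Bool) (v : Word (n + 1) (D + 1)) : Word (n + 1) (D + 1) := permW (Equiv.swap a 0) (posW b v)

/-- `denormFirst ∘ normFirst = id`. [cite: MadrasSlade1993, Definition 1.2.4] -/
theorem denormFirst_normFirst (a : Fin (D + 1)) (b : Bool) (u : Word (n + 1) (D + 1)) : denormFirst a b (normFirst a b u) = u := by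
  unfold denormFirst normFirst; rw [posW_posW, permW_swap_permW_swap]

/-- `normFirst ∘ denormFirst = id`. [cite: MadrasSlade1993, Definition 1.2.4] -/
theorem normFirst_denormFirst (a : Fin (D + 1)) (b : Bool) (v : Word (n + 1) (D + 1)) : normFirst a b (denormFirst a b v) = v := by
  unfold denormFirst normFirst; rw [permW_swap_permW_swap, posW_posW]

/-- The normalised word starts with `(0, true)` when the word starts with `(a, b)`. [cite: MadrasSlade1993, Definition 1.2.4] -/
theorem normFirst_zero (a : Fin (D + 1)) (b : Bool) (u : Word (n + 1) (D + 1)) (h : u 0 = (a, b)) : normFirst a b u 0 = (0, true) := by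
  unfold normFirst posW permW
  cases b
  · simp only [Bool.false_eq_true, if_false]
    unfold flipW
    simp [h, Equiv.swap_apply_left]
  · simp [h, Equiv.swap_apply_left]

/-- The denormalised word starts with `(a, b)` when the word starts with `(0, true)`. [cite: MadrasSlade1993, Definition 1.2.4] -/
theorem denormFirst_zero (a : Fin (D + 1)) (b : Bool) (v : Word (n + 1) (D + 1)) (h : v 0 = (0, true)) : denormFirst a b v 0 = (a, b) := by
  unfold denormFirst posW permW
  cases b
  · simp only [Bool.false_eq_true, if_false]
    unfold flipW
    simp [h, Equiv.swap_apply_right]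
  · simp [h, Equiv.swap_apply_right]

open Classical in
/-- ★ Every first-letter slice of the bridge class has the size of the step-up slice. [cite: MadrasSlade1993, Definition 1.2.4] -/
theorem card_slice_eq (c : ℕ) (a : Fin (D + 1)) (b : Bool) :
    (Finset.univ.filter fun u : Word (n + 1) (D + 1) => u 0 = (a, b) ∧ QB c u).card =
      (Finset.univ.filter fun v : Word (n + 1) (D + 1) => v 0 = (0, true) ∧ QB c v).card := by
  refine Finset.card_bij' (fun u _ => normFirst a b u) (fun v _ => denormFirst a b v) (fun u hu => ?_) (fun v hv => ?_)
    (fun u _ => denormFirst_normFirst a b u) (fun v _ => normFirst_denormFirst a b v)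
  · rw [Finset.mem_filter] at hu ⊢
    refine ⟨Finset.mem_univ _, normFirst_zero a b u hu.2.1, ?_⟩
    unfold normFirst; rw [qb_posW_iff, qb_permW_iff]; exact hu.2.2
  · rw [Finset.mem_filter] at hv ⊢
    refine ⟨Finset.mem_univ _, denormFirst_zero a b v hv.2.1, ?_⟩
    unfold denormFirst; rw [qb_permW_iff, qb_posW_iff]; exact hv.2.2

open Classical in
/-- ★★ THE BRIDGE CLASS IS `2(D+1)` STEP-UP SLICES: `#{u | QB c u} = 2(D+1) · #{u | u 0 = (0,true) ∧ QB c u}`. [cite: MadrasSlade1993, Definition 1.2.4] -/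
theorem card_qb_eq_mul (c : ℕ) :
    (Finset.univ.filter fun u : Word (n + 1) (D + 1) => QB c u).card =
      2 * (D + 1) * (Finset.univ.filter fun v : Word (n + 1) (D + 1) => v 0 = (0, true) ∧ QB c v).card := by
  rw [Finset.card_eq_sum_card_fiberwise (f := fun u : Word (n + 1) (D + 1) => u 0) (t := Finset.univ) (fun u _ => Finset.mem_univ _)]
  have h : ∀ ℓ : Idx (D + 1), ((Finset.univ.filter fun u : Word (n + 1) (D + 1) => QB c u).filter fun u => u 0 = ℓ).card =
      (Finset.univ.filter fun v : Word (n + 1) (D + 1) => v 0 = (0, true) ∧ QB c v).card := by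
    intro ℓ
    obtain ⟨a, b⟩ := ℓ
    rw [Finset.filter_filter, ← card_slice_eq c a b]
    congr 1
    exact Finset.filter_congr fun u _ => and_comm
  rw [Finset.sum_congr rfl fun ℓ _ => h ℓ, Finset.sum_const, Finset.card_univ, card_idx, smul_eq_mul]

end slices

/-! ### ★★★ The cost census from the reduced search over bridge words -/

section census3

variable {n : ℕ} (ok : List (ℕ × Bool) → Bool) (cls : ℕ → List (ℕ × Bool) → Bool)

open Classical in
/-- ★★★ THE COST CENSUS BY THE SEARCH ENGINE: if the raw tests of the search mean the bridge class of cost `c` on canonical words, then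
`2(d+1) · N_{c,n+1}(ℤ^{d+1}) = Σ_k 2^k m_k (d+1)^{(k)}` with `m_k` the REDUCED search counts (canonical bridge words with positive first
occurrences and `k` axes in all, the pulled axis included). [cite: MadrasSlade1993, §4.2, eq. (4.2.20)–(4.2.22) (p. 94, 2013 reprint)] -/
theorem two_mul_costCoeffZd_eq_sum (d c c' : ℕ)
    (hsem : ∀ τ : Word (n + 1) (n + 1), (PrefixOK updR ok ([] : List (ℕ × Bool)) τ ∧ cls c' (st updR [] (rawW τ)) = true) ↔ QB c τ)
    (m : ℕ → ℕ) (hm : ∀ k, k ≤ n + 1 → dfsN alwR updR ok cls c' k (n + 1) ([] : List (ℕ × Bool)) 0 = m k) :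
    2 * (d + 1) * costCoeffZd d c (n + 1) = ∑ k ∈ Finset.range (n + 2), 2 ^ k * m k * (d + 1).descFactorial k := by
  rw [costCoeffZd_eq_card_qb, ← card_qb_eq_mul]
  exact card_eq_sum_dfsN_reduced updR ok cls ([] : List (ℕ × Bool)) c' (fun u : Word (n + 1) (d + 1) => QB c u)
    (fun u => by rw [qb_iff_canon, hsem]) (fun S τ => by rw [hsem, hsem, qb_flipW_iff]) m hm

open Classical in
/-- ★★★ **`N_{c,n+1}(ℤ^{d+1}) = Σ_k 2^k m_{k+1} d^{(k)}`** — the cost census in every dimension from the reduced search counts (no word has zero axes: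
`m 0 = 0`). [cite: MadrasSlade1993, §4.2, eq. (4.2.20)–(4.2.22) (p. 94, 2013 reprint)] -/
theorem costCoeffZd_eq_sum_search (d c c' : ℕ)
    (hsem : ∀ τ : Word (n + 1) (n + 1), (PrefixOK updR ok ([] : List (ℕ × Bool)) τ ∧ cls c' (st updR [] (rawW τ)) = true) ↔ QB c τ)
    (m : ℕ → ℕ) (hm : ∀ k, k ≤ n + 1 → dfsN alwR updR ok cls c' k (n + 1) ([] : List (ℕ × Bool)) 0 = m k) (hm0 : m 0 = 0) :
    costCoeffZd d c (n + 1) = ∑ k ∈ Finset.range (n + 1), 2 ^ k * m (k + 1) * d.descFactorial k := by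
  have h := two_mul_costCoeffZd_eq_sum ok cls d c c' hsem m hm
  rw [Finset.sum_range_succ', hm0, mul_zero, zero_mul, add_zero] at h
  have e : ∑ k ∈ Finset.range (n + 1), 2 ^ (k + 1) * m (k + 1) * (d + 1).descFactorial (k + 1) =
      2 * (d + 1) * ∑ k ∈ Finset.range (n + 1), 2 ^ k * m (k + 1) * d.descFactorial k := by
    rw [Finset.mul_sum]
    refine Finset.sum_congr rfl fun k _ => ?_
    rw [Nat.succ_descFactorial_succ, pow_succ]
    ring
  rw [e] at h
  exact Nat.eq_of_mul_eq_mul_left (by omega) h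

end census3

end WordTypes

end Literature.Probability.RandomPlanarGeometry.SAW.Zd
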